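import Summits.FinalStateConjecture.FinalStateConjecture.Theses.PhotonSphereChannels
import Summits.FinalStateConjecture.FinalStateConjecture.Theorems.PhotonSphereChannelsKerrDevDefs
import Summits.FinalStateConjecture.FinalStateConjecture.Theorems.PhotonSphereChannelsDarkFutureDefs
import Summits.FinalStateConjecture.FinalStateConjecture.Theorems.PhotonSphereChannelsChannelsResolveTameDevelopmentsRRayClauseSplit
import Summits.FinalStateConjecture.FinalStateConjecture.Theorems.PhotonSphereChannelsChannelsResolveTameDevelopmentsRHullRigidGivenSEK
import Summits.FinalStateConjecture.FinalStateConjecture.Theorems.PhotonSphereChannelsChannelsResolveTameDevelopmentsRDockTransfer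
import Summits.FinalStateConjecture.FinalStateConjecture.Theorems.PhotonSphereChannelsChannelsResolveTameDevelopmentsRDockReadyTransfer
import Summits.FinalStateConjecture.FinalStateConjecture.Theorems.PhotonSphereChannelsChannelsResolveTameDevelopmentsRDockReadyTransferNR
import Summits.FinalStateConjecture.FinalStateConjecture.Theorems.PhotonSphereChannelsChannelsResolveTameDevelopmentsRDockReadyTransferFlat
import Summits.FinalStateConjecture.FinalStateConjecture.Theses.EternalPapapetrou
import Summits.FinalStateConjecture.FinalStateConjecture.Theses.TangentConeAtIPlus
import Literature.Geometry.Lorentzian.Stationary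
import Literature.Geometry.Lorentzian.KerrData
import Literature.Geometry.Lorentzian.Geodesic
import Literature.Geometry.Lorentzian.Causality
import Literature.Geometry.Lorentzian.Einstein
import HarnessLib.Audit

/-!
# Line `tame-lasalle-dock` — skeleton for crux
`PhotonSphereChannels.ChannelsResolveTameDevelopmentsR` (stmt-FinalStateConjecture-17430, K2R-T2)

Crux-strategist ALTERNATIVE line (planner-cstrat-stmt-FinalStateConjecture-17430-s1-0, 2026-08-17), picked and led by
prover-line-stmt-FinalStateConjecture-17430-c8-0 (PICKED.md). **Reshapes 1/1b/1c/1d (lead c8, 2026-08-17; 1b: producer A′ → A″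
without the unused shadowing clause; 1c: the representative of stub D is only NON-RADIATING and its embedding carries NO orientation
clause; 1d: stub N in the ♭ form — a Kerr-looking d.o.c. also looks sub-extremal):** (α) the two docks
L = item stmt-10034 and U = item stmt-10745 are replaced by the ONE dock stub SEK `stub_silentEternalIsKerr` — their
all-orders composite, strictly WEAKER than `L ∧ U` and the only thing the composition consumes; the proof
`L → U → SEK` stays in §2b (`silentEternalIsKerr_of_far_of_stationary`, sorry-free), so SEK closes the moment the two
items close; (β) stub R `stub_hullRigidGivenSEK` is now a THEOREM (`hullRigid_of_SEK_of_dockReady_of_noExtremalShadow`,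
§2c) from SEK and two NEW, smaller stubs: `stub_dockReadyHull` (every silent hull element of a development as in Φ is
DOCK-READY: itself globally hyperbolic and complete, or represented by a globally hyperbolic black-hole-or-complete
silent end carrying an isometric copy of its d.o.c.; flat elements have empty horizon) and `stub_noExtremalShadow` (no
hull element has d.o.c. isometric to an EXTREMAL Kerr exterior — hypothesis (i) in ω-limit form). The glue is LANDED:
`TameLaSalle.isMinkowski_or_exists_isKerrDoc_of_silentEternalIsKerr` (p159494: far data from the class, all-orders
non-radiation G1, orientation fix G4b, exactness G4, `isMinkowski_of_isIsometry` for U's Minkowski disjunct),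
`TameLaSalle.isKerrDoc_image_of_isLocalIsometry` / `kerrExteriorUpToOrientation_image` (p159726: push-forward along the
representative's embedding), `TameLaSalle.isMinkowski_or_isKerrDoc_of_dockReady` (per-element transfer). WHY
REPRESENTATIVES: hull elements carry no covering clause (`SubconvergesLocallyTo.restrict'`), so an element trimmed
inside its black-hole region is again an element and is NOT globally hyperbolic, while its d.o.c. is unchanged —
"every element is globally hyperbolic" would be false, "every element has a globally hyperbolic representative with the
same d.o.c." is the honest content. Line card: `Lines/tame-lasalle-dock.md`; strategy census: `STRATEGY-CENSUS.md`.

## The line in one paragraph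

K2R-T2 is `K1R → Φ_T2` with `K1R` a theorem, i.e. tame `T2` final-state resolution. Every earlier line re-derived
the same open core — rigidity of silent eternal vacuum black-hole exteriors — as a PRIVATE stub; this line DOCKS it:
SEK ("silent eternal vacua are Kerr or Minkowski", all orders) is the composite of route EternalPapapetrou's items
stmt-10034 (far-zone eternal Papapetrou) and stmt-10745 (eternal stationary exterior is Kerr), proved from them in
§2b. Since SEK classifies EVERY silent hull element (∀-form), no window isolation / clopen / ∃-core machinery is
needed: the producer A″ `stub_silentHullCore` (A′ minus the unused shadowing clause, Reshape 1b) gives the class and the hulls; `stub_dockReadyHull` + `stub_noExtremalShadow`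
make every element dockable; SEK + the landed transfer classify it (Minkowski or EXACT sub-extremal Kerr d.o.c.);
K♭ `stub_kerrParametersConstantAlong` pins one `(M, a)` per generator; T′ `stub_tameEndgame` builds the honest
decomposition; C `stub_settledExteriorHoldsRays` (= item stmt-17673 verbatim) gives the ray clause.

COMPOSITION (§4, sorry-free): A″ gives the class, the hulls and `outerRegion ≠ ∅`; R (theorem) from SEK, DockReady,
NoExtremalShadow; K♭ pins one `(M, a)` per generator; T′ gives K2R♭; `RayClause…of_rayClause` with C gives the crux
BY NAME.

## Disproof used (`Cruxes/ChannelsResolveTameDevelopmentsR/Disproof.lean`, cdisprove v3.1, unchanged at 12:00Z 2026-08-17)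

(a) `tameResolution_false_without_maximal_and_complete` ({`IsMaximal`, complete `𝓘⁺`} jointly load-bearing):
honoured — both are consumed by A″ (`DevHyp`) and T′ and kept by C; SEK is about eternal objects; DockReady /
NoExtremalShadow / K♭ are `DevHyp`-guarded. (b) `Negative/TameChartsBoostBlind`: all end-side statements are over the
clock-adapted balls of `IsTameEnd`/`IsTameEndOrder`. (c) `Negative/SilenceCalculus`: no one-time silence; `IsSilent`
is eternal. (d) §8.2 `bag_exposure`: (C) docked to 17673. (e) `Negative/KerrIsolationClosurePoints`: SEK and the
transfer conclude on `docOfEnd (range far)` = `E.doc` only, under global hyperbolicity + black-hole-or-complete of the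
REPRESENTATIVE. (f) `Negative/EmptyHorizonEnd` (extremal white-hole patch: neither black-hole w.r.t. its end nor
complete, d.o.c. extremal): as a hull element it is excluded exactly by `stub_noExtremalShadow`; as a bare end it is not
claimed. No `-- Targets` exist against this line.
-/

noncomputable section

set_option maxSynthPendingDepth 3
set_option linter.dupNamespace false

open Set Filter Function TopologicalSpace Manifold Bundle
open scoped Topology Manifold ContDiff ENNReal NNReal BigOperators

namespace Summit.FinalStateConjecture.FinalStateConjecture.Cruxes.ChannelsResolveTameDevelopmentsR.TameLaSalleDock

open Literature.Geometry.Lorentzian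
open Summit.FinalStateConjecture.FinalStateConjecture.Theorems.TameHull
open Summit.FinalStateConjecture.FinalStateConjecture.Theses.PhotonSphereChannels
  (ChannelsResolveTameDevelopmentsR UniformPhotonSphereChannelsR)

/-! ### §2 Stub statements (named `def … : Prop`) and the registered stubs `stub_*` (same text) -/

/-- **Stub A″ — `SilentHullCore`** (Reshape 1b of lead c8 = the inherited producer A′ `stub_silentHull` of line
`dark-future-exactness` MINUS its clause (c) `OuterHullShadowed`, which this line's composition never uses — SEK classifies
outer elements directly, so no shadowing onto generators is needed; the producer (F5) `HorizonThreading` thereby leaves the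
crux's residue; `TameLaSalle.silentHullCore_of_producers` proves A″ from (F1) `HasCompleteRay`, (F0) `AllOrdersTameOuter`,
(F4a) `EventuallyTameAlongHorizon`, (F2) `TameEndOfOuterLimit`, (F4b) `TameEndOfHorizonLimit`, (F3) `SilentUpgrade` —
stub-worker A's typed producers, p159801). For an MGHD of admissible data with complete `𝓘⁺`, (i), (ii) (`DevHyp`): the
outer region is nonempty and there is ONE all-orders class `(Λ, r₀)` with silent outer hull elements along every
future-escaping outer sequence and horizon-hull elements along every generator path and subsequence. Why it might fail: the
uniform far constants fail if curvature concentrations recede unboundedly (census (E)); the all-orders clause from `C³` (ii)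
is the crux-TEXT regularity debt (F0), flagged by every lead and triager. Size XL.
[cite: Anderson2004, Thm 5.1] [cite: ChruscielEtAl2001, Thm 1.1] [cite: ChristodoulouKlainerman1993, Ch. 17] -/
def SilentHullCore : Prop :=
    ∀ (X : Type) [TopologicalSpace X] [ChartedSpace E3 X] [IsManifold (𝓡 3) ∞ X] [T2Space X]
      [SecondCountableTopology X] [ConnectedSpace X], ∀ D ∈ admissibleVacuumData X,
      ∀ (𝒟 : VacuumCauchyDevelopment D) [𝒟.metric.HasLeviCivita], DevHyp 𝒟 →
        (outerRegion 𝒟).Nonempty ∧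
        ∃ (Λ : ℕ → ℝ≥0) (r₀ : ℝ), 0 < r₀ ∧ OuterHullExists 𝒟 Λ r₀ ∧ GeneratorHullExists 𝒟 Λ r₀

/-- Registered stub `stub_silentHullCore` (statement = `SilentHullCore`, verbatim). [folklore] -/
theorem stub_silentHullCore :
    ∀ (X : Type) [TopologicalSpace X] [ChartedSpace E3 X] [IsManifold (𝓡 3) ∞ X] [T2Space X]
      [SecondCountableTopology X] [ConnectedSpace X], ∀ D ∈ admissibleVacuumData X,
      ∀ (𝒟 : VacuumCauchyDevelopment D) [𝒟.metric.HasLeviCivita], DevHyp 𝒟 →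
        (outerRegion 𝒟).Nonempty ∧
        ∃ (Λ : ℕ → ℝ≥0) (r₀ : ℝ), 0 < r₀ ∧ OuterHullExists 𝒟 Λ r₀ ∧ GeneratorHullExists 𝒟 Λ r₀ := by
  sorry

/-- **Dock L — `FarZoneEternalPapapetrou` = item stmt-FinalStateConjecture-10034 VERBATIM (route `EternalPapapetrou`,
crux rank 2). Not a stub after Reshape 1: it enters only through `silentEternalIsKerr_of_far_of_stationary`.** Far-zone eternal Papapetrou at
finite order: an eternal vacuum far chart on `{r > R}`, `C^k·(1/r)`-close to Schwarzschild uniformly in `t`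
and two-sided non-radiating at order `1/r`, carries a timelike Killing field near infinity. Why it might
fail: Alexakis–Schlue need periodicity / full expansions and conclude only near `i⁰`; finite-order unique
continuation from `𝓘` fails for `□ + V`. Size: item (XL). [cite: AlexakisSchlue2018, Thm 1.2] -/
def FarZoneEternalPapapetrou : Prop :=
  ∃ k : ℕ, ∀ (M R C : ℝ), 0 ≤ M → max (2 * M) 0 < R → ∀ (𝓢 : Literature.Geometry.Lorentzian.Spacetime.{0} 4) [𝓢.metric.toPseudoRiemannianMetric.HasLeviCivita], 𝓢.metric.toPseudoRiemannianMetric.IsRicciFlat → ∀ (Φ : Literature.Geometry.Lorentzian.Kerr.region (0 : ℝ) R → 𝓢.carrier), IsLocalDiffeomorph 𝓘(ℝ, Literature.Geometry.Lorentzian.E4) (𝓡 4) (⊤ : ℕ∞) Φ → Function.Injective Φ → let B : Literature.Geometry.Lorentzian.ModelBackground := ⟨Literature.Geometry.Lorentzian.Kerr.region 0 R, Literature.Geometry.Lorentzian.Kerr.bilin M 0, fun x ↦ x 0, Literature.Geometry.Lorentzian.Kerr.radius 0⟩; let h : Literature.Geometry.Lorentzian.E4 → Literature.Geometry.Lorentzian.E4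 →L[ℝ] Literature.Geometry.Lorentzian.E4 →L[ℝ] ℝ := 𝓢.deviationExtend B Φ; let hₜ : Literature.Geometry.Lorentzian.E4 → Literature.Geometry.Lorentzian.E4 →L[ℝ] Literature.Geometry.Lorentzian.E4 →L[ℝ] ℝ := fun y ↦ fderiv ℝ h y (Literature.Geometry.Lorentzian.E4.basisVector 0); (∀ m ≤ k, ∀ x : Literature.Geometry.Lorentzian.Kerr.region (0 : ℝ) R, ‖iteratedFDeriv ℝ m h x.1‖ * Literature.Geometry.Lorentzian.Kerr.radius 0 x.1 ≤ C) → (∀ m < k, ∀ δ > (0 : ℝ), ∃ R' : ℝ, ∀ x : Literature.Geometry.Lorentzian.Kerr.region (0 : ℝ) R, R' < Literature.Geometry.Lorentzian.Kerr.radius 0 x.1 → ‖iteratedFDeriv ℝ m hₜ x.1‖ * Literature.Geometry.Lorentzian.Kerr.radius 0 x.1 ≤ δ) → ∃ (R₁ : ℝ) (T : Literature.Geometry.Lorentzian.E4 → Literature.Geometry.Lorentzian.E4), R ≤ R₁ ∧ ContDiffOn ℝ (⊤ : ℕ∞) T {y | R₁ < Literature.Geometry.Lorentzian.Kerr.radius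 0 y} ∧ ∀ y : Literature.Geometry.Lorentzian.E4, R₁ < Literature.Geometry.Lorentzian.Kerr.radius 0 y → (h y + Literature.Geometry.Lorentzian.Kerr.bilin M 0 y) (T y) (T y) < 0 ∧ ∀ v w : Literature.Geometry.Lorentzian.E4, (fderiv ℝ (fun z ↦ h z + Literature.Geometry.Lorentzian.Kerr.bilin M 0 z) y (T y)) v w + (h y + Literature.Geometry.Lorentzian.Kerr.bilin M 0 y) (fderiv ℝ T y v) w + (h y + Literature.Geometry.Lorentzian.Kerr.bilin M 0 y) v (fderiv ℝ T y w) = 0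

/-- **Dock U — `EternalStationaryExteriorIsKerr` = item stmt-FinalStateConjecture-10745 VERBATIM (route
`EternalPapapetrou`, crux rank 4). Not a stub after Reshape 1: it enters only through
`silentEternalIsKerr_of_far_of_stationary`.** No-hair for ETERNAL
limits without analyticity: a Ricci-flat globally hyperbolic spacetime with an eternal far chart as in L plus
L's conclusion, which is a black-hole spacetime w.r.t. the far end or timelike- and null-geodesically
complete, has d.o.c. isometric to a Kerr exterior `0 < M'`, `|a| ≤ M'` or is Minkowski. THE HARDEST STUB
(smooth stationary black-hole uniqueness + no eternal geon) — shared and already staffed. Why it might fail: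
Killing extension inward through the photon region without analyticity/smallness is open (Ionescu–Klainerman
counterexamples across null hypersurfaces). Size: item (open problem). [cite: AlexakisIonescuKlainerman2009, Thm 1.1]
[cite: IonescuKlainerman2012, Thm 1.1] [cite: ChruscielCosta2008, Thm 1.1] -/
def EternalStationaryExteriorIsKerr : Prop :=
  ∃ k : ℕ, ∀ (M R C : ℝ), 0 ≤ M → max (2 * M) 0 < R → ∀ (𝓢 : Literature.Geometry.Lorentzian.Spacetime.{0} 4) [𝓢.metric.toPseudoRiemannianMetric.HasLeviCivita] [Literature.Geometry.Lorentzian.Kerr.Facts], 𝓢.metric.toPseudoRiemannianMetric.IsRicciFlat → 𝓢.metric.IsGloballyHyperbolic 𝓢.timeOrientation → ∀ (Φ : Literature.Geometry.Lorentzian.Kerr.region (0 : ℝ) R → 𝓢.carrier), IsLocalDiffeomorph 𝓘(ℝ, Literature.Geometry.Lorentzian.E4) (𝓡 4) (⊤ : ℕ∞) Φ → Function.Injective Φ → let B : Literature.Geometry.Lorentzian.ModelBackground := ⟨Literature.Geometry.Lorentzian.Kerr.region 0 R, Literature.Geometry.Lorentzian.Kerr.bilin M 0, fun x ↦ x 0,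 Literature.Geometry.Lorentzian.Kerr.radius 0⟩; let h : Literature.Geometry.Lorentzian.E4 → Literature.Geometry.Lorentzian.E4 →L[ℝ] Literature.Geometry.Lorentzian.E4 →L[ℝ] ℝ := 𝓢.deviationExtend B Φ; let hₜ : Literature.Geometry.Lorentzian.E4 → Literature.Geometry.Lorentzian.E4 →L[ℝ] Literature.Geometry.Lorentzian.E4 →L[ℝ] ℝ := fun y ↦ fderiv ℝ h y (Literature.Geometry.Lorentzian.E4.basisVector 0); (∀ m ≤ k, ∀ x : Literature.Geometry.Lorentzian.Kerr.region (0 : ℝ) R, ‖iteratedFDeriv ℝ m h x.1‖ * Literature.Geometry.Lorentzian.Kerr.radius 0 x.1 ≤ C) → (∀ m < k, ∀ δ > (0 : ℝ), ∃ R' : ℝ, ∀ x : Literature.Geometry.Lorentzian.Kerr.region (0 : ℝ) R, R' < Literature.Geometry.Lorentzian.Kerr.radius 0 x.1 → ‖iteratedFDeriv ℝ m hₜ x.1‖ * Literature.Geometry.Lorentzian.Kerr.radius 0 x.1 ≤ δ) → (∃ (R₁ : ℝ) (T : Literature.Geometry.Lorentzian.E4 → Literature.Geometry.Lorentzian.E4),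 R ≤ R₁ ∧ ContDiffOn ℝ (⊤ : ℕ∞) T {y | R₁ < Literature.Geometry.Lorentzian.Kerr.radius 0 y} ∧ ∀ y : Literature.Geometry.Lorentzian.E4, R₁ < Literature.Geometry.Lorentzian.Kerr.radius 0 y → (h y + Literature.Geometry.Lorentzian.Kerr.bilin M 0 y) (T y) (T y) < 0 ∧ ∀ v w : Literature.Geometry.Lorentzian.E4, (fderiv ℝ (fun z ↦ h z + Literature.Geometry.Lorentzian.Kerr.bilin M 0 z) y (T y)) v w + (h y + Literature.Geometry.Lorentzian.Kerr.bilin M 0 y) (fderiv ℝ T y v) w + (h y + Literature.Geometry.Lorentzian.Kerr.bilin M 0 y) v (fderiv ℝ T y w) = 0) → ((𝓢.blackHoleRegionOfEnd (Set.range Φ)).Nonempty ∨ (𝓢.metric.IsTimelikeGeodesicallyComplete ∧ 𝓢.metric.IsNullGeodesicallyComplete)) → (∃ (M' a : ℝ), 0 < M' ∧ |a| ≤ M' ∧ ∃ Ψ : Literature.Geometry.Lorentzian.Kerr.exterior M' a → 𝓢.carrier, Function.Injective Ψ ∧ Set.range Ψ = 𝓢.docOfEnd (Set.range Φ) ∧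 Literature.Geometry.Lorentzian.PseudoRiemannianMetric.IsLocalIsometry (Literature.Geometry.Lorentzian.Kerr.smoothMetric M' a (Literature.Geometry.Lorentzian.Kerr.rPlus M' a)).toPseudoRiemannianMetric 𝓢.metric.toPseudoRiemannianMetric Ψ) ∨ (∃ Ψ : Diffeomorph (𝓡 4) 𝓘(ℝ, Literature.Geometry.Lorentzian.E4) 𝓢.carrier Literature.Geometry.Lorentzian.E4 (⊤ : ℕ∞), Literature.Geometry.Lorentzian.PseudoRiemannianMetric.IsIsometry 𝓢.metric.toPseudoRiemannianMetric (Literature.Geometry.Lorentzian.Minkowski.metric.ofLE le_top : Literature.Geometry.Lorentzian.LorentzianMetric 𝓘(ℝ, Literature.Geometry.Lorentzian.E4) (⊤ : ℕ∞) Literature.Geometry.Lorentzian.E4).toPseudoRiemannianMetric Ψ)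

/-- **SEK — silent eternal vacua are Kerr or Minkowski, all-orders form** (**the ONE dock stub after
Reshape 1**: `stub_silentEternalIsKerr`; proved below from L and U, §2b, so it closes when items stmt-10034 and
stmt-10745 close; strictly weaker than `L ∧ U`). Every Ricci-flat, globally hyperbolic spacetime with an eternal far chart on `{r > R}` whose
deviation from Schwarzschild obeys `‖D^m h‖·r ≤ C m` at every order and is two-sided non-radiating at order
`1/r` at every order, and which is a black-hole spacetime w.r.t. the far end or timelike+null geodesically
complete, has d.o.c. isometric to a Kerr exterior (`0 < M'`, `|a| ≤ M'`) or is Minkowski. [cite: KenigMerle2006, §4] -/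
def SilentEternalIsKerr : Prop :=
  ∀ (M R : ℝ) (C : ℕ → ℝ), 0 ≤ M → max (2 * M) 0 < R → ∀ (𝓢 : Literature.Geometry.Lorentzian.Spacetime.{0} 4) [𝓢.metric.toPseudoRiemannianMetric.HasLeviCivita] [Literature.Geometry.Lorentzian.Kerr.Facts], 𝓢.metric.toPseudoRiemannianMetric.IsRicciFlat → 𝓢.metric.IsGloballyHyperbolic 𝓢.timeOrientation → ∀ (Φ : Literature.Geometry.Lorentzian.Kerr.region (0 : ℝ) R → 𝓢.carrier), IsLocalDiffeomorph 𝓘(ℝ, Literature.Geometry.Lorentzian.E4) (𝓡 4) (⊤ : ℕ∞) Φ → Function.Injective Φ → let B : Literature.Geometry.Lorentzian.ModelBackground := ⟨Literature.Geometry.Lorentzian.Kerr.region 0 R, Literature.Geometry.Lorentzian.Kerr.bilin M 0, fun x ↦ x 0, Literature.Geometry.Lorentzian.Kerr.radius 0⟩; let h : Literature.Geometry.Lorentzian.E4 → Literature.Geometry.Lorentzian.E4 →L[ℝ] Literature.Geometry.Lorentzian.E4 →L[ℝ] ℝ := 𝓢.deviationExtend B Φ; let hₜ : Literature.Geometry.Lorentzian.E4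 → Literature.Geometry.Lorentzian.E4 →L[ℝ] Literature.Geometry.Lorentzian.E4 →L[ℝ] ℝ := fun y ↦ fderiv ℝ h y (Literature.Geometry.Lorentzian.E4.basisVector 0); (∀ (m : ℕ) (x : Literature.Geometry.Lorentzian.Kerr.region (0 : ℝ) R), ‖iteratedFDeriv ℝ m h x.1‖ * Literature.Geometry.Lorentzian.Kerr.radius 0 x.1 ≤ C m) → (∀ (m : ℕ), ∀ δ > (0 : ℝ), ∃ R' : ℝ, ∀ x : Literature.Geometry.Lorentzian.Kerr.region (0 : ℝ) R, R' < Literature.Geometry.Lorentzian.Kerr.radius 0 x.1 → ‖iteratedFDeriv ℝ m hₜ x.1‖ * Literature.Geometry.Lorentzian.Kerr.radius 0 x.1 ≤ δ) → ((𝓢.blackHoleRegionOfEnd (Set.range Φ)).Nonempty ∨ (𝓢.metric.IsTimelikeGeodesicallyComplete ∧ 𝓢.metric.IsNullGeodesicallyComplete)) → (∃ (M' a : ℝ), 0 < M' ∧ |a| ≤ M' ∧ ∃ Ψ : Literature.Geometry.Lorentzian.Kerr.exterior M' a → 𝓢.carrier, Function.Injective Ψ ∧ Set.range Ψ = 𝓢.docOfEnd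 (Set.range Φ) ∧ Literature.Geometry.Lorentzian.PseudoRiemannianMetric.IsLocalIsometry (Literature.Geometry.Lorentzian.Kerr.smoothMetric M' a (Literature.Geometry.Lorentzian.Kerr.rPlus M' a)).toPseudoRiemannianMetric 𝓢.metric.toPseudoRiemannianMetric Ψ) ∨ (∃ Ψ : Diffeomorph (𝓡 4) 𝓘(ℝ, Literature.Geometry.Lorentzian.E4) 𝓢.carrier Literature.Geometry.Lorentzian.E4 (⊤ : ℕ∞), Literature.Geometry.Lorentzian.PseudoRiemannianMetric.IsIsometry 𝓢.metric.toPseudoRiemannianMetric (Literature.Geometry.Lorentzian.Minkowski.metric.ofLE le_top : Literature.Geometry.Lorentzian.LorentzianMetric 𝓘(ℝ, Literature.Geometry.Lorentzian.E4) (⊤ : ℕ∞) Literature.Geometry.Lorentzian.E4).toPseudoRiemannianMetric Ψ)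

/-- Registered stub `stub_silentEternalIsKerr` (statement = `SilentEternalIsKerr`, verbatim; DOCK = items stmt-10034 ∧
stmt-10745 through `silentEternalIsKerr_of_far_of_stationary`). [cite: AlexakisIonescuKlainerman2009, Thm 1.1] -/
theorem stub_silentEternalIsKerr :
    ∀ (M R : ℝ) (C : ℕ → ℝ), 0 ≤ M → max (2 * M) 0 < R → ∀ (𝓢 : Literature.Geometry.Lorentzian.Spacetime.{0} 4) [𝓢.metric.toPseudoRiemannianMetric.HasLeviCivita] [Literature.Geometry.Lorentzian.Kerr.Facts], 𝓢.metric.toPseudoRiemannianMetric.IsRicciFlat → 𝓢.metric.IsGloballyHyperbolic 𝓢.timeOrientation → ∀ (Φ : Literature.Geometry.Lorentzian.Kerr.region (0 : ℝ) R → 𝓢.carrier), IsLocalDiffeomorph 𝓘(ℝ, Literature.Geometry.Lorentzian.E4) (𝓡 4) (⊤ : ℕ∞) Φ → Function.Injective Φ → let B : Literature.Geometry.Lorentzian.ModelBackground := ⟨Literature.Geometry.Lorentzian.Kerr.region 0 R, Literature.Geometry.Lorentzian.Kerr.bilin M 0, fun x ↦ x 0, Literature.Geometry.Lorentzian.Kerr.radius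 0⟩; let h : Literature.Geometry.Lorentzian.E4 → Literature.Geometry.Lorentzian.E4 →L[ℝ] Literature.Geometry.Lorentzian.E4 →L[ℝ] ℝ := 𝓢.deviationExtend B Φ; let hₜ : Literature.Geometry.Lorentzian.E4 → Literature.Geometry.Lorentzian.E4 →L[ℝ] Literature.Geometry.Lorentzian.E4 →L[ℝ] ℝ := fun y ↦ fderiv ℝ h y (Literature.Geometry.Lorentzian.E4.basisVector 0); (∀ (m : ℕ) (x : Literature.Geometry.Lorentzian.Kerr.region (0 : ℝ) R), ‖iteratedFDeriv ℝ m h x.1‖ * Literature.Geometry.Lorentzian.Kerr.radius 0 x.1 ≤ C m) → (∀ (m : ℕ), ∀ δ > (0 : ℝ), ∃ R' : ℝ, ∀ x : Literature.Geometry.Lorentzian.Kerr.region (0 : ℝ) R, R' < Literature.Geometry.Lorentzian.Kerr.radius 0 x.1 → ‖iteratedFDeriv ℝ m hₜ x.1‖ * Literature.Geometry.Lorentzian.Kerr.radius 0 x.1 ≤ δ) → ((𝓢.blackHoleRegionOfEnd (Set.range Φ)).Nonempty ∨ (𝓢.metric.IsTimelikeGeodesicallyComplete ∧ 𝓢.metric.IsNullGeodesicallyComplete))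 → (∃ (M' a : ℝ), 0 < M' ∧ |a| ≤ M' ∧ ∃ Ψ : Literature.Geometry.Lorentzian.Kerr.exterior M' a → 𝓢.carrier, Function.Injective Ψ ∧ Set.range Ψ = 𝓢.docOfEnd (Set.range Φ) ∧ Literature.Geometry.Lorentzian.PseudoRiemannianMetric.IsLocalIsometry (Literature.Geometry.Lorentzian.Kerr.smoothMetric M' a (Literature.Geometry.Lorentzian.Kerr.rPlus M' a)).toPseudoRiemannianMetric 𝓢.metric.toPseudoRiemannianMetric Ψ) ∨ (∃ Ψ : Diffeomorph (𝓡 4) 𝓘(ℝ, Literature.Geometry.Lorentzian.E4) 𝓢.carrier Literature.Geometry.Lorentzian.E4 (⊤ : ℕ∞), Literature.Geometry.Lorentzian.PseudoRiemannianMetric.IsIsometry 𝓢.metric.toPseudoRiemannianMetric (Literature.Geometry.Lorentzian.Minkowski.metric.ofLE le_top : Literature.Geometry.Lorentzian.LorentzianMetric 𝓘(ℝ, Literature.Geometry.Lorentzian.E4) (⊤ : ℕ∞) Literature.Geometry.Lorentzian.E4).toPseudoRiemannianMetric Ψ) := by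
  sorry

/-- **Stub D — `DockReadyHull` (NEW, Reshape 1 of lead c8; the causal half of old R's side conditions (2), (3)).**
For a development as in Φ and a class `(Λ, r₀)`, every SILENT HULL ELEMENT `(𝓢, E, p)` — a silent outer hull element
along some future-escaping outer sequence, or a horizon-hull element along some horizon generator path — is
DOCK-READY: (G6) if `𝓢` is Minkowski then `E.horizon = ∅` (a flat spacetime has no event horizon w.r.t. an eternal
`O(1/r)`-Schwarzschild far chart: asymptotic inertiality); and EITHER (case B) `𝓢` itself is globally hyperbolic and
timelike- and null-geodesically complete (horizonless full elements), OR (case A) there is a REPRESENTATIVE: a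
NON-RADIATING end `(𝓢', E')` in some all-orders class (Reshape 1c: the transfer consumes only non-radiation), `𝓢'`
globally hyperbolic and black-hole w.r.t. `E'` or complete (so SEK applies to it), with an injective local isometry
`j : 𝓢' → 𝓢` (NO orientation clause: SEK's raw output is pushed forward and re-processed in the element,
`TameLaSalle.isMinkowski_or_isKerrDoc_of_dockReady_flat`), `j '' E'.doc = E.doc`, and `IsMinkowski 𝓢' → IsMinkowski 𝓢`
(a flat representative only of a flat element). Intended witnesses: for
an honest limit, the sub-spacetime `E.doc ∪ collar` of the canonical (maximal) limit along the same subsequence, which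
inherits global hyperbolicity from `𝒟`; `j` = inclusion. Why it is not "every element is globally hyperbolic": hull
elements carry no covering clause, and an element trimmed inside its black-hole region is again an element, not globally
hyperbolic, with the same d.o.c. Why it might fail: global hyperbolicity of `doc ∪ collar` for a limit that is only
`C²_loc`-approximated (causal pathologies at the edge of the covered region); completeness of horizonless elements with
empty black-hole region (boost-blind tame balls, `Negative/TameChartsBoostBlind`); (G6) asymptotic inertiality. Size L.
[cite: Wald1984, §12.1] [cite: HawkingEllis1973, §6.6] -/
def DockReadyHull : Prop :=
    ∀ (X : Type) [TopologicalSpace X] [ChartedSpace E3 X] [IsManifold (𝓡 3) ∞ X] [T2Space X]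
      [SecondCountableTopology X] [ConnectedSpace X], ∀ D ∈ admissibleVacuumData X,
      ∀ (𝒟 : VacuumCauchyDevelopment D) [𝒟.metric.HasLeviCivita], DevHyp 𝒟 →
        ∀ (Λ : ℕ → ℝ≥0) (r₀ : ℝ) (𝓢 : Spacetime.{0} 4) (E : EndDatum 𝓢) (p : 𝓢.carrier),
          ((∃ q : ℕ → 𝒟.carrier, IsSilentHullElement 𝒟 Λ r₀ q 𝓢 E p) ∨
            (∃ (γ : ℝ → 𝒟.carrier) (s : ℕ → ℝ), IsHorizonPath 𝒟 γ ∧ Tendsto s atTop atTop ∧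
              IsHorizonHullElementAlong 𝒟 Λ r₀ γ s 𝓢 E p)) →
          (IsMinkowski 𝓢 → E.horizon = ∅) ∧
          ∀ [𝓢.metric.HasLeviCivita],
            (𝓢.metric.IsGloballyHyperbolic 𝓢.timeOrientation ∧ 𝓢.metric.IsTimelikeGeodesicallyComplete ∧
                𝓢.metric.IsNullGeodesicallyComplete) ∨
            (∃ (𝓢' : Spacetime.{0} 4) (E' : EndDatum 𝓢') (Λ' : ℕ → ℝ≥0) (r₀' : ℝ) (j : 𝓢'.carrier → 𝓢.carrier),
              IsTameClass E' Λ' r₀' ∧ E'.IsNonRadiating ∧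
              (∀ [𝓢'.metric.HasLeviCivita], 𝓢'.metric.IsGloballyHyperbolic 𝓢'.timeOrientation ∧
                ((𝓢'.blackHoleRegionOfEnd (Set.range E'.far)).Nonempty ∨
                  (𝓢'.metric.IsTimelikeGeodesicallyComplete ∧ 𝓢'.metric.IsNullGeodesicallyComplete))) ∧
              Function.Injective j ∧
              PseudoRiemannianMetric.IsLocalIsometry 𝓢'.metric.toPseudoRiemannianMetric
                𝓢.metric.toPseudoRiemannianMetric j ∧
              j '' E'.doc = E.doc ∧ (IsMinkowski 𝓢' → IsMinkowski 𝓢))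

/-- Registered stub `stub_dockReadyHull` (statement = `DockReadyHull`, verbatim). [folklore] -/
theorem stub_dockReadyHull :
    ∀ (X : Type) [TopologicalSpace X] [ChartedSpace E3 X] [IsManifold (𝓡 3) ∞ X] [T2Space X]
      [SecondCountableTopology X] [ConnectedSpace X], ∀ D ∈ admissibleVacuumData X,
      ∀ (𝒟 : VacuumCauchyDevelopment D) [𝒟.metric.HasLeviCivita], DevHyp 𝒟 →
        ∀ (Λ : ℕ → ℝ≥0) (r₀ : ℝ) (𝓢 : Spacetime.{0} 4) (E : EndDatum 𝓢) (p : 𝓢.carrier),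
          ((∃ q : ℕ → 𝒟.carrier, IsSilentHullElement 𝒟 Λ r₀ q 𝓢 E p) ∨
            (∃ (γ : ℝ → 𝒟.carrier) (s : ℕ → ℝ), IsHorizonPath 𝒟 γ ∧ Tendsto s atTop atTop ∧
              IsHorizonHullElementAlong 𝒟 Λ r₀ γ s 𝓢 E p)) →
          (IsMinkowski 𝓢 → E.horizon = ∅) ∧
          ∀ [𝓢.metric.HasLeviCivita],
            (𝓢.metric.IsGloballyHyperbolic 𝓢.timeOrientation ∧ 𝓢.metric.IsTimelikeGeodesicallyComplete ∧
                𝓢.metric.IsNullGeodesicallyComplete) ∨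
            (∃ (𝓢' : Spacetime.{0} 4) (E' : EndDatum 𝓢') (Λ' : ℕ → ℝ≥0) (r₀' : ℝ) (j : 𝓢'.carrier → 𝓢.carrier),
              IsTameClass E' Λ' r₀' ∧ E'.IsNonRadiating ∧
              (∀ [𝓢'.metric.HasLeviCivita], 𝓢'.metric.IsGloballyHyperbolic 𝓢'.timeOrientation ∧
                ((𝓢'.blackHoleRegionOfEnd (Set.range E'.far)).Nonempty ∨
                  (𝓢'.metric.IsTimelikeGeodesicallyComplete ∧ 𝓢'.metric.IsNullGeodesicallyComplete))) ∧
              Function.Injective j ∧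
              PseudoRiemannianMetric.IsLocalIsometry 𝓢'.metric.toPseudoRiemannianMetric
                𝓢.metric.toPseudoRiemannianMetric j ∧
              j '' E'.doc = E.doc ∧ (IsMinkowski 𝓢' → IsMinkowski 𝓢)) := by
  sorry

/-- **Stub N — `NoExtremalShadow` (NEW, Reshape 1 of lead c8; ♭ form since Reshape 1d; old R's item (5), hypothesis (i) in
ω-limit form).** For a development as in Φ and a class `(Λ, r₀)`, `0 < r₀`, with precompact generator hull
(`GeneratorHullExists`), every silent hull element whose domain of outer communications LOOKS KERR — is the
image of an injective local isometry of some Kerr exterior `(M', a)`, `0 < M'`, `|a| ≤ M'`, in either time orientation — also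
looks SUB-EXTREMAL: some sub-extremal Kerr exterior `(M₂, a₂)`, `|a₂| < M₂`, maps the same way onto the same d.o.c. (the ♭ form
does not contain the uniqueness fact "extremal ≇ sub-extremal Kerr exterior", a slice of K♭'s (U); the old form `|a| < M'`
implies it with `(M₂, a₂) = (M', a)`). Content: no element has an EXTREMAL-ONLY Kerr d.o.c. Reshape 1e: stated for the classes the
composition uses (`0 < r₀`, `GeneratorHullExists` — supplied by A″), the shape in which stub-worker N's typed decomposition
`TameLaSalle.noExtremalShadow_ofClass_of_rebase_of_pinning_of_gluing` (p162154/p162392: (E1) extremal outer shadows re-base onto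
the horizon ∧ (E2) extremal pinning along generators ∧ (E3) late chart of an extremal generator ⇒ a late chart converging to
extremal Kerr, against (i) `NoExtremalRemnant`) proves its un-flattened form. Hypothesis (i) `NoExtremalRemnant` excludes late CHARTS converging to extremal Kerr along all
times; an extremal hull element is convergence along a subsequence of times on exhausting windows — the promotion from
the second to the first (parameters pinned along the generator by the two monotone budgets, so that one extremal element
makes the whole late evolution extremal) is the content ("ExtremalLimitPromotion", TSOA dead note; third-law-type).
Also excludes the extremal white-hole patch of `Negative/EmptyHorizonEnd` as an outer element. Why it might fail: a
vacuum analogue of Kehle–Unger extremal formation reached only asymptotically with oscillating parameters. Size L–XL.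
[cite: DafermosLuk2017, §1.2.1] [cite: Wald1984, §12.5] -/
def NoExtremalShadow : Prop :=
    ∀ (X : Type) [TopologicalSpace X] [ChartedSpace E3 X] [IsManifold (𝓡 3) ∞ X] [T2Space X]
      [SecondCountableTopology X] [ConnectedSpace X], ∀ D ∈ admissibleVacuumData X,
      ∀ (𝒟 : VacuumCauchyDevelopment D) [𝒟.metric.HasLeviCivita], DevHyp 𝒟 →
        ∀ (Λ : ℕ → ℝ≥0) (r₀ : ℝ), 0 < r₀ → GeneratorHullExists 𝒟 Λ r₀ →
        ∀ (𝓢 : Spacetime.{0} 4) (E : EndDatum 𝓢) (p : 𝓢.carrier),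
          ((∃ q : ℕ → 𝒟.carrier, IsSilentHullElement 𝒟 Λ r₀ q 𝓢 E p) ∨
            (∃ (γ : ℝ → 𝒟.carrier) (s : ℕ → ℝ), IsHorizonPath 𝒟 γ ∧ Tendsto s atTop atTop ∧
              IsHorizonHullElementAlong 𝒟 Λ r₀ γ s 𝓢 E p)) →
          ∀ [Kerr.Facts], ∀ M' a : ℝ, 0 < M' → |a| ≤ M' →
            (∃ Ψ : Kerr.exterior M' a → 𝓢.carrier, Function.Injective Ψ ∧ Set.range Ψ = E.doc ∧
              PseudoRiemannianMetric.IsLocalIsometry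
                (Kerr.smoothMetric M' a (Kerr.rPlus M' a)).toPseudoRiemannianMetric
                𝓢.metric.toPseudoRiemannianMetric Ψ) →
            ∃ M₂ a₂ : ℝ, 0 < M₂ ∧ |a₂| < M₂ ∧
              ∃ Ψ₂ : Kerr.exterior M₂ a₂ → 𝓢.carrier, Function.Injective Ψ₂ ∧ Set.range Ψ₂ = E.doc ∧
                PseudoRiemannianMetric.IsLocalIsometry
                  (Kerr.smoothMetric M₂ a₂ (Kerr.rPlus M₂ a₂)).toPseudoRiemannianMetric
                  𝓢.metric.toPseudoRiemannianMetric Ψ₂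

/-- Registered stub `stub_noExtremalShadow` (statement = `NoExtremalShadow`, verbatim). [folklore] -/
theorem stub_noExtremalShadow :
    ∀ (X : Type) [TopologicalSpace X] [ChartedSpace E3 X] [IsManifold (𝓡 3) ∞ X] [T2Space X]
      [SecondCountableTopology X] [ConnectedSpace X], ∀ D ∈ admissibleVacuumData X,
      ∀ (𝒟 : VacuumCauchyDevelopment D) [𝒟.metric.HasLeviCivita], DevHyp 𝒟 →
        ∀ (Λ : ℕ → ℝ≥0) (r₀ : ℝ), 0 < r₀ → GeneratorHullExists 𝒟 Λ r₀ →
        ∀ (𝓢 : Spacetime.{0} 4) (E : EndDatum 𝓢) (p : 𝓢.carrier),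
          ((∃ q : ℕ → 𝒟.carrier, IsSilentHullElement 𝒟 Λ r₀ q 𝓢 E p) ∨
            (∃ (γ : ℝ → 𝒟.carrier) (s : ℕ → ℝ), IsHorizonPath 𝒟 γ ∧ Tendsto s atTop atTop ∧
              IsHorizonHullElementAlong 𝒟 Λ r₀ γ s 𝓢 E p)) →
          ∀ [Kerr.Facts], ∀ M' a : ℝ, 0 < M' → |a| ≤ M' →
            (∃ Ψ : Kerr.exterior M' a → 𝓢.carrier, Function.Injective Ψ ∧ Set.range Ψ = E.doc ∧
              PseudoRiemannianMetric.IsLocalIsometry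
                (Kerr.smoothMetric M' a (Kerr.rPlus M' a)).toPseudoRiemannianMetric
                𝓢.metric.toPseudoRiemannianMetric Ψ) →
            ∃ M₂ a₂ : ℝ, 0 < M₂ ∧ |a₂| < M₂ ∧
              ∃ Ψ₂ : Kerr.exterior M₂ a₂ → 𝓢.carrier, Function.Injective Ψ₂ ∧ Set.range Ψ₂ = E.doc ∧
                PseudoRiemannianMetric.IsLocalIsometry
                  (Kerr.smoothMetric M₂ a₂ (Kerr.rPlus M₂ a₂)).toPseudoRiemannianMetric
                  𝓢.metric.toPseudoRiemannianMetric Ψ₂ := by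
  sorry

/-- **Stub K♭ — `KerrParametersConstantAlong` (NEW; = DFE's K with the window-isolation hypothesis
REMOVED and the ∃-witness replaced by the ∀-classification R supplies; L, point-set topology + two monotone
budgets).** For a DevHyp development and a class with precompactness of the generator hull, along every
horizon generator path `γ`: if EVERY horizon-hull element along `γ` has a sub-extremal Kerr d.o.c., then ONE
sub-extremal `(M, a)` fits them all. Proof shape: `Ω_γ` is compact (precompactness + diagonal closedness)
and CONNECTED (`…RHullDichotomy`, `…RHullConnectednessIVT`, landed); the parameter map is continuous on the
Kerr locus (= all of `Ω_γ` here); PINNING: horizon area monotone along `γ` hence constant on limits, the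
hole's mass of bounded variation ⇒ finitely many admissible `(M, ±a)` ⇒ constant on the connected `Ω_γ`
(abstract step LANDED: `…RPinnedClopenLocus`, p149021); the sign of `a` cannot flip unless `a = 0`.
Why it might fail: only through the budget inputs (area theorem along `γ`, horizon lineage, mass budget
over `CauchyDevelopment`). Size L. [cite: Hale1980, Ch. I §8 Thm. 8.1] [cite: ChruscielEtAl2001, Thm 1.1] -/
def KerrParametersConstantAlong : Prop :=
    ∀ (X : Type) [TopologicalSpace X] [ChartedSpace E3 X] [IsManifold (𝓡 3) ∞ X] [T2Space X]
      [SecondCountableTopology X] [ConnectedSpace X], ∀ D ∈ admissibleVacuumData X,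
      ∀ (𝒟 : VacuumCauchyDevelopment D) [𝒟.metric.HasLeviCivita], DevHyp 𝒟 →
        ∀ (Λ : ℕ → ℝ≥0) (r₀ : ℝ), 0 < r₀ → GeneratorHullExists 𝒟 Λ r₀ →
          ∀ γ : ℝ → 𝒟.carrier, IsHorizonPath 𝒟 γ →
            (∀ (𝓢 : Spacetime.{0} 4) (E : EndDatum 𝓢) (p : 𝓢.carrier),
              IsHorizonHullElement 𝒟 Λ r₀ γ 𝓢 E p → ∃ M a : ℝ, 0 < M ∧ |a| < M ∧ IsKerrDoc 𝓢 E.doc M a) →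
            ∃ M a : ℝ, 0 < M ∧ |a| < M ∧
              ∀ (𝓢 : Spacetime.{0} 4) (E : EndDatum 𝓢) (p : 𝓢.carrier),
                IsHorizonHullElement 𝒟 Λ r₀ γ 𝓢 E p → IsKerrDoc 𝓢 E.doc M a

/-- Registered stub `stub_kerrParametersConstantAlong` (statement = `KerrParametersConstantAlong`, verbatim). [folklore] -/
theorem stub_kerrParametersConstantAlong :
    ∀ (X : Type) [TopologicalSpace X] [ChartedSpace E3 X] [IsManifold (𝓡 3) ∞ X] [T2Space X]
      [SecondCountableTopology X] [ConnectedSpace X], ∀ D ∈ admissibleVacuumData X,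
      ∀ (𝒟 : VacuumCauchyDevelopment D) [𝒟.metric.HasLeviCivita], DevHyp 𝒟 →
        ∀ (Λ : ℕ → ℝ≥0) (r₀ : ℝ), 0 < r₀ → GeneratorHullExists 𝒟 Λ r₀ →
          ∀ γ : ℝ → 𝒟.carrier, IsHorizonPath 𝒟 γ →
            (∀ (𝓢 : Spacetime.{0} 4) (E : EndDatum 𝓢) (p : 𝓢.carrier),
              IsHorizonHullElement 𝒟 Λ r₀ γ 𝓢 E p → ∃ M a : ℝ, 0 < M ∧ |a| < M ∧ IsKerrDoc 𝓢 E.doc M a) →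
            ∃ M a : ℝ, 0 < M ∧ |a| < M ∧
              ∀ (𝓢 : Spacetime.{0} 4) (E : EndDatum 𝓢) (p : 𝓢.carrier),
                IsHorizonHullElement 𝒟 Λ r₀ γ 𝓢 E p → IsKerrDoc 𝓢 E.doc M a := by
  sorry

/-- **Stub T′ — `TameEndgame`** (= the registered `stub_tameEndgame` of line `dark-future-exactness`,
VERBATIM; XL assembly, shared): DevHyp + nonempty outer region + [class with (a), (b), (c) every silent
outer hull element Minkowski-or-sub-extremal-Kerr, (d) one sub-extremal `(M, a)` per generator path] ⇒ the
K2R♭ conclusion. Why it might fail: uniformity of the `C² ⇒ C³` bootstrap across infinitely many gluings;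
Bondi mass over `CauchyDevelopment` undefined in tree. Size XL. [cite: DafermosLuk2017, Conjecture 1]
[cite: KobayashiNomizu1963, VI Thm 6.2] -/
def TameEndgame : Prop :=
    ∀ (X : Type) [TopologicalSpace X] [ChartedSpace E3 X] [IsManifold (𝓡 3) ∞ X] [T2Space X]
      [SecondCountableTopology X] [ConnectedSpace X], ∀ D ∈ admissibleVacuumData X,
      ∀ (𝒟 : VacuumCauchyDevelopment D) [𝒟.metric.HasLeviCivita], DevHyp 𝒟 →
        (outerRegion 𝒟).Nonempty →
        (∃ (Λ : ℕ → ℝ≥0) (r₀ : ℝ), 0 < r₀ ∧ OuterHullExists 𝒟 Λ r₀ ∧ GeneratorHullExists 𝒟 Λ r₀ ∧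
          (∀ (q : ℕ → 𝒟.carrier) (𝓢 : Spacetime.{0} 4) (E : EndDatum 𝓢) (p : 𝓢.carrier),
            IsSilentHullElement 𝒟 Λ r₀ q 𝓢 E p →
              IsMinkowski 𝓢 ∨ ∃ M a : ℝ, 0 < M ∧ |a| < M ∧ IsKerrDoc 𝓢 E.doc M a) ∧
          (∀ γ : ℝ → 𝒟.carrier, IsHorizonPath 𝒟 γ → ∃ M a : ℝ, 0 < M ∧ |a| < M ∧
            ∀ (𝓢 : Spacetime.{0} 4) (E : EndDatum 𝓢) (p : 𝓢.carrier),
              IsHorizonHullElement 𝒟 Λ r₀ γ 𝓢 E p → IsKerrDoc 𝓢 E.doc M a)) →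
        ∃ (O : Set 𝒟.carrier) (d : FinalStateDecomposition 𝒟.toSpacetime O 2),
          O = _root_.Summit.FinalStateConjecture.exteriorOf 𝒟.toCauchyDevelopment d.charted ∧
            _root_.Summit.FinalStateConjecture.HasExhaustiveCharts d ∧
              _root_.Summit.FinalStateConjecture.IsFutureOriented d

/-- Registered stub `stub_tameEndgame` (statement = `TameEndgame`, verbatim). [folklore] -/
theorem stub_tameEndgame :
    ∀ (X : Type) [TopologicalSpace X] [ChartedSpace E3 X] [IsManifold (𝓡 3) ∞ X] [T2Space X]
      [SecondCountableTopology X] [ConnectedSpace X], ∀ D ∈ admissibleVacuumData X,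
      ∀ (𝒟 : VacuumCauchyDevelopment D) [𝒟.metric.HasLeviCivita], DevHyp 𝒟 →
        (outerRegion 𝒟).Nonempty →
        (∃ (Λ : ℕ → ℝ≥0) (r₀ : ℝ), 0 < r₀ ∧ OuterHullExists 𝒟 Λ r₀ ∧ GeneratorHullExists 𝒟 Λ r₀ ∧
          (∀ (q : ℕ → 𝒟.carrier) (𝓢 : Spacetime.{0} 4) (E : EndDatum 𝓢) (p : 𝓢.carrier),
            IsSilentHullElement 𝒟 Λ r₀ q 𝓢 E p →
              IsMinkowski 𝓢 ∨ ∃ M a : ℝ, 0 < M ∧ |a| < M ∧ IsKerrDoc 𝓢 E.doc M a) ∧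
          (∀ γ : ℝ → 𝒟.carrier, IsHorizonPath 𝒟 γ → ∃ M a : ℝ, 0 < M ∧ |a| < M ∧
            ∀ (𝓢 : Spacetime.{0} 4) (E : EndDatum 𝓢) (p : 𝓢.carrier),
              IsHorizonHullElement 𝒟 Λ r₀ γ 𝓢 E p → IsKerrDoc 𝓢 E.doc M a)) →
        ∃ (O : Set 𝒟.carrier) (d : FinalStateDecomposition 𝒟.toSpacetime O 2),
          O = _root_.Summit.FinalStateConjecture.exteriorOf 𝒟.toCauchyDevelopment d.charted ∧
            _root_.Summit.FinalStateConjecture.HasExhaustiveCharts d ∧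
              _root_.Summit.FinalStateConjecture.IsFutureOriented d := by
  sorry

/-- **Stub C — `SettledExteriorHoldsRays` = item stmt-FinalStateConjecture-17673 VERBATIM (DOCK, shared with
the live line and routes `TangentConeAtIPlus` / `RaychaudhuriBlowdown`).** The ray-closure clause (C).
Why it might fail: hidden expanding bag on `Σ = ℝ³ # ℍ³/Γ` (operator-level). Size: item.
[cite: DafermosLuk2017, Conjecture 1] -/
def SettledExteriorHoldsRays : Prop :=
  open Literature.Geometry.Lorentzian in open scoped ContDiff in ∀ (X : Type) [TopologicalSpace X] [ChartedSpace E3 X] [IsManifold (𝓡 3) ∞ X] [T2Space X] [SecondCountableTopology X] [ConnectedSpace X] (D : InitialDataSet (𝓡 3) X), D ∈ admissibleVacuumData X → ∀ 𝒟 : VacuumCauchyDevelopment D, 𝒟.IsMaximal → Summit.FinalStateConjecture.HasCompleteNullInfinity 𝒟.toCauchyDevelopment → ∀ (O : Set 𝒟.carrier) (fd : FinalStateDecomposition 𝒟.toSpacetime O 2), (∀ i, Kerr.IsSubextremal (fd.mass i) (fd.spin i)) → O = Summit.FinalStateConjecture.exteriorOf 𝒟.toCauchyDevelopment fd.charted →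 Summit.FinalStateConjecture.HasExhaustiveCharts fd → Summit.FinalStateConjecture.IsFutureOriented fd → Summit.FinalStateConjecture.RaysStayInClosure 𝒟.toCauchyDevelopment O

/-- Registered stub `stub_settledExteriorHoldsRays` (statement = item stmt-17673, verbatim). [folklore] -/
theorem stub_settledExteriorHoldsRays :
    open Literature.Geometry.Lorentzian in open scoped ContDiff in ∀ (X : Type) [TopologicalSpace X] [ChartedSpace E3 X] [IsManifold (𝓡 3) ∞ X] [T2Space X] [SecondCountableTopology X] [ConnectedSpace X] (D : InitialDataSet (𝓡 3) X), D ∈ admissibleVacuumData X → ∀ 𝒟 : VacuumCauchyDevelopment D, 𝒟.IsMaximal → Summit.FinalStateConjecture.HasCompleteNullInfinity 𝒟.toCauchyDevelopment → ∀ (O : Set 𝒟.carrier) (fd : FinalStateDecomposition 𝒟.toSpacetime O 2), (∀ i, Kerr.IsSubextremal (fd.mass i) (fd.spin i)) → O = Summit.FinalStateConjecture.exteriorOf 𝒟.toCauchyDevelopment fd.charted → Summit.FinalStateConjecture.HasExhaustiveCharts fd → Summit.FinalStateConjecture.IsFutureOriented fd → Summit.FinalStateConjecture.RaysStayInClosure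 𝒟.toCauchyDevelopment O := by
  sorry

/-! ### §2b SEK from the two docks (PROVED): `FarZoneEternalPapapetrou → EternalStationaryExteriorIsKerr → SilentEternalIsKerr` -/

/-- **L → U → SEK.** Instantiate the orders `k_L`, `k_U` of the two items, dominate the all-orders
constants `C m`, `m ≤ max k_L k_U`, by `∑ |C m|`, get the far Killing field from L and feed U.
Sorry-free (same proof as the strategist's Theses-free split file `…RSplit.lean`, evidence on stmt-17430).
[cite: KenigMerle2006, §4] -/
theorem silentEternalIsKerr_of_far_of_stationary (hL : FarZoneEternalPapapetrou)
    (hU : EternalStationaryExteriorIsKerr) : SilentEternalIsKerr := by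
  obtain ⟨k₁, hk₁⟩ := hL
  obtain ⟨k₂, hk₂⟩ := hU
  intro M R C hM hR 𝓢 _ _ hRic hGH Φ hΦ hinj B h hₜ hbd hnr hbh
  set C' : ℝ := ∑ m ∈ Finset.range (max k₁ k₂ + 1), |C m| with hC'
  have hdom : ∀ m ≤ max k₁ k₂, C m ≤ C' := by
    intro m hm
    have hmem : m ∈ Finset.range (max k₁ k₂ + 1) := Finset.mem_range.mpr (Nat.lt_succ_of_le hm)
    calc C m ≤ |C m| := le_abs_self _
      _ ≤ C' := by
        rw [hC']
        exact Finset.single_le_sum (f := fun j => |C j|) (fun j _ => abs_nonneg _) hmem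
  have hbd₁ : ∀ m ≤ k₁, ∀ x : Literature.Geometry.Lorentzian.Kerr.region (0 : ℝ) R,
      ‖iteratedFDeriv ℝ m h x.1‖ * Literature.Geometry.Lorentzian.Kerr.radius 0 x.1 ≤ C' :=
    fun m hm x => (hbd m x).trans (hdom m (hm.trans (le_max_left _ _)))
  have hbd₂ : ∀ m ≤ k₂, ∀ x : Literature.Geometry.Lorentzian.Kerr.region (0 : ℝ) R,
      ‖iteratedFDeriv ℝ m h x.1‖ * Literature.Geometry.Lorentzian.Kerr.radius 0 x.1 ≤ C' :=
    fun m hm x => (hbd m x).trans (hdom m (hm.trans (le_max_right _ _)))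
  have hnr₁ : ∀ m < k₁, ∀ δ > (0 : ℝ), ∃ R' : ℝ, ∀ x : Literature.Geometry.Lorentzian.Kerr.region (0 : ℝ) R,
      R' < Literature.Geometry.Lorentzian.Kerr.radius 0 x.1 →
        ‖iteratedFDeriv ℝ m hₜ x.1‖ * Literature.Geometry.Lorentzian.Kerr.radius 0 x.1 ≤ δ :=
    fun m _ => hnr m
  have hnr₂ : ∀ m < k₂, ∀ δ > (0 : ℝ), ∃ R' : ℝ, ∀ x : Literature.Geometry.Lorentzian.Kerr.region (0 : ℝ) R,
      R' < Literature.Geometry.Lorentzian.Kerr.radius 0 x.1 →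
        ‖iteratedFDeriv ℝ m hₜ x.1‖ * Literature.Geometry.Lorentzian.Kerr.radius 0 x.1 ≤ δ :=
    fun m _ => hnr m
  have hKilling := hk₁ M R C' hM hR 𝓢 hRic Φ hΦ hinj hbd₁ hnr₁
  exact hk₂ M R C' hM hR 𝓢 hRic hGH Φ hΦ hinj hbd₂ hnr₂ hKilling hbh


/-! ### §2d Dock certificates: the dock texts are the ITEMS, definitionally -/

/-- L is item stmt-FinalStateConjecture-10034 (`Theses.EternalPapapetrou.FarZoneEternalPapapetrou`) verbatim. -/
example : FarZoneEternalPapapetrou ↔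
    Summit.FinalStateConjecture.FinalStateConjecture.Theses.EternalPapapetrou.FarZoneEternalPapapetrou := Iff.rfl

/-- U is item stmt-FinalStateConjecture-10745 (`Theses.EternalPapapetrou.EternalStationaryExteriorIsKerr`) verbatim. -/
example : EternalStationaryExteriorIsKerr ↔
    Summit.FinalStateConjecture.FinalStateConjecture.Theses.EternalPapapetrou.EternalStationaryExteriorIsKerr := Iff.rfl

/-- C is item stmt-FinalStateConjecture-17673 (`Theses.TangentConeAtIPlus.SettledExteriorHoldsRays`) verbatim. -/
example : SettledExteriorHoldsRays ↔
    Summit.FinalStateConjecture.FinalStateConjecture.Theses.TangentConeAtIPlus.SettledExteriorHoldsRays := Iff.rfl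

/-- **SEK from the two ITEMS** (the dock in item form): when stmt-10034 and stmt-10745 are proved, `stub_silentEternalIsKerr`
closes by this theorem. Sorry-free. [cite: AlexakisIonescuKlainerman2009, Thm 1.1] -/
theorem silentEternalIsKerr_of_items
    (hL : Summit.FinalStateConjecture.FinalStateConjecture.Theses.EternalPapapetrou.FarZoneEternalPapapetrou)
    (hU : Summit.FinalStateConjecture.FinalStateConjecture.Theses.EternalPapapetrou.EternalStationaryExteriorIsKerr) :
    SilentEternalIsKerr :=
  silentEternalIsKerr_of_far_of_stationary hL hU

/-! ### §2c Old stub R is a THEOREM: `HullRigid` from SEK, DockReady and NoExtremalShadow (landed glue) -/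

/-- The text of the retired stub R `HullRigidGivenSEK`'s CONCLUSION (R1 ∧ R2), kept as a named statement: every silent
outer hull element is Minkowski or has a sub-extremal Kerr d.o.c.; every horizon-hull element has a sub-extremal Kerr
d.o.c. [cite: DafermosLuk2017, Conjecture 1] -/
def HullRigid : Prop :=
    (∀ (X : Type) [TopologicalSpace X] [ChartedSpace E3 X] [IsManifold (𝓡 3) ∞ X] [T2Space X]
        [SecondCountableTopology X] [ConnectedSpace X], ∀ D ∈ admissibleVacuumData X,
        ∀ (𝒟 : VacuumCauchyDevelopment D) [𝒟.metric.HasLeviCivita], DevHyp 𝒟 →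
          ∀ (Λ : ℕ → ℝ≥0) (r₀ : ℝ), 0 < r₀ → GeneratorHullExists 𝒟 Λ r₀ →
          ∀ (q : ℕ → 𝒟.carrier) (𝓢 : Spacetime.{0} 4) (E : EndDatum 𝓢)
            (p : 𝓢.carrier), IsSilentHullElement 𝒟 Λ r₀ q 𝓢 E p →
            IsMinkowski 𝓢 ∨ ∃ M a : ℝ, 0 < M ∧ |a| < M ∧ IsKerrDoc 𝓢 E.doc M a) ∧
      (∀ (X : Type) [TopologicalSpace X] [ChartedSpace E3 X] [IsManifold (𝓡 3) ∞ X] [T2Space X]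
        [SecondCountableTopology X] [ConnectedSpace X], ∀ D ∈ admissibleVacuumData X,
        ∀ (𝒟 : VacuumCauchyDevelopment D) [𝒟.metric.HasLeviCivita], DevHyp 𝒟 →
          ∀ (Λ : ℕ → ℝ≥0) (r₀ : ℝ), 0 < r₀ → GeneratorHullExists 𝒟 Λ r₀ →
          ∀ (γ : ℝ → 𝒟.carrier), IsHorizonPath 𝒟 γ →
            ∀ (𝓢 : Spacetime.{0} 4) (E : EndDatum 𝓢) (p : 𝓢.carrier),
              IsHorizonHullElement 𝒟 Λ r₀ γ 𝓢 E p → ∃ M a : ℝ, 0 < M ∧ |a| < M ∧ IsKerrDoc 𝓢 E.doc M a)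

/-- **R as a theorem (Reshape 1, final glue since 1c/1d).** SEK + DockReady + NoExtremalShadow ⇒ `HullRigid`, by the landed
per-element transfer `TameLaSalle.isMinkowski_or_isKerrDoc_of_dockReady_flat` (p159494/p159726/p160011/p161655 + the ♭ file); for horizon-hull elements the
Minkowski branch is excluded by (G6) and `p ∈ E.horizon`. Sorry-free. [cite: DafermosLuk2017, Conjecture 1] -/
theorem hullRigid_of_SEK_of_dockReady_of_noExtremalShadow (hSEK : SilentEternalIsKerr) (hD : DockReadyHull)
    (hN : NoExtremalShadow) : HullRigid := by
  haveI hKF : Kerr.Facts :=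
    ⟨Kerr.isConnected_region_holds, Kerr.contMDiff_bilin_holds, Kerr.contMDiff_timeVector_holds⟩
  refine ⟨?_, ?_⟩
  · intro X _ _ _ _ _ _ D hD' 𝒟 _ hdev Λ r₀ hr₀ hgen q 𝓢 E p hZ
    haveI : 𝓢.metric.HasLeviCivita := 𝓢.metric.toPseudoRiemannianMetric.hasLeviCivita
    obtain ⟨-, hready⟩ := hD X D hD' 𝒟 hdev Λ r₀ 𝓢 E p (Or.inl ⟨q, hZ⟩)
    exact Summit.FinalStateConjecture.FinalStateConjecture.Theorems.TameLaSalle.isMinkowski_or_isKerrDoc_of_dockReady_flat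
      hSEK E hZ.2.1 hZ.2.2.1.1 hready (hN X D hD' 𝒟 hdev Λ r₀ hr₀ hgen 𝓢 E p (Or.inl ⟨q, hZ⟩))
  · intro X _ _ _ _ _ _ D hD' 𝒟 _ hdev Λ r₀ hr₀ hgen γ hγ 𝓢 E p hZ
    haveI : 𝓢.metric.HasLeviCivita := 𝓢.metric.toPseudoRiemannianMetric.hasLeviCivita
    obtain ⟨s, hs, hZs⟩ := hZ
    obtain ⟨hG6, hready⟩ := hD X D hD' 𝒟 hdev Λ r₀ 𝓢 E p (Or.inr ⟨γ, s, hγ, hs, hZs⟩)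
    rcases Summit.FinalStateConjecture.FinalStateConjecture.Theorems.TameLaSalle.isMinkowski_or_isKerrDoc_of_dockReady_flat
        hSEK E hZs.1 hZs.2.1.1 hready (hN X D hD' 𝒟 hdev Λ r₀ hr₀ hgen 𝓢 E p (Or.inr ⟨γ, s, hγ, hs, hZs⟩)) with hflat | hkerr
    · have hp : p ∈ E.horizon := hZs.2.2.1
      rw [hG6 hflat] at hp
      exact absurd hp (Set.notMem_empty p)
    · exact hkerr

/-! ### §3 Name-keyed aliases of the registered stubs; consistency -/

namespace Registered
/-- Statement of `stub_silentHullCore` (= `SilentHullCore`). [folklore] -/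
abbrev stub_silentHullCore : Prop := SilentHullCore
/-- Statement of `stub_silentEternalIsKerr` (= `SilentEternalIsKerr`). [folklore] -/
abbrev stub_silentEternalIsKerr : Prop := SilentEternalIsKerr
/-- Statement of `stub_dockReadyHull` (= `DockReadyHull`). [folklore] -/
abbrev stub_dockReadyHull : Prop := DockReadyHull
/-- Statement of `stub_noExtremalShadow` (= `NoExtremalShadow`). [folklore] -/
abbrev stub_noExtremalShadow : Prop := NoExtremalShadow
/-- Statement of `stub_kerrParametersConstantAlong` (= `KerrParametersConstantAlong`). [folklore] -/
abbrev stub_kerrParametersConstantAlong : Prop := KerrParametersConstantAlong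
/-- Statement of `stub_tameEndgame` (= `TameEndgame`). [folklore] -/
abbrev stub_tameEndgame : Prop := TameEndgame
/-- Statement of `stub_settledExteriorHoldsRays` (= `SettledExteriorHoldsRays`). [folklore] -/
abbrev stub_settledExteriorHoldsRays : Prop := SettledExteriorHoldsRays
end Registered

/-- Consistency check: the registered (sorried) stubs prove their name-keyed statements. -/
example : Registered.stub_silentHullCore ∧ Registered.stub_silentEternalIsKerr ∧
    Registered.stub_dockReadyHull ∧ Registered.stub_noExtremalShadow ∧
    Registered.stub_kerrParametersConstantAlong ∧ Registered.stub_tameEndgame ∧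
    Registered.stub_settledExteriorHoldsRays :=
  ⟨stub_silentHullCore, stub_silentEternalIsKerr, stub_dockReadyHull, stub_noExtremalShadow,
    stub_kerrParametersConstantAlong, stub_tameEndgame, stub_settledExteriorHoldsRays⟩

/-! ### §4 The composition (kernel-checked, no `sorry` of its own): the crux BY NAME -/

/-- **Logic of the line: the seven stub STATEMENTS imply the crux.** A″'s class, hulls and nonempty outer
region; SEK (dock); R as a theorem from SEK, D, N (§2c); K♭ pins one `(M, a)` per generator; T′ gives K2R♭; the
docked ray clause C and the landed `RayClause.channelsResolveTameDevelopmentsR_of_rayClause` give the crux; the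
antecedent `K1R` is discarded. Sorry-free. -/
theorem channelsResolveTameDevelopmentsR_of_stubs (hA : Registered.stub_silentHullCore)
    (hSEK : Registered.stub_silentEternalIsKerr) (hD : Registered.stub_dockReadyHull)
    (hN : Registered.stub_noExtremalShadow) (hK : Registered.stub_kerrParametersConstantAlong)
    (hT : Registered.stub_tameEndgame) (hC : Registered.stub_settledExteriorHoldsRays) :
    ChannelsResolveTameDevelopmentsR := by
  refine Summit.FinalStateConjecture.FinalStateConjecture.Theorems.ChannelsResolveTameDevelopmentsR.RayClause.channelsResolveTameDevelopmentsR_of_rayClause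
    hC ?_
  intro _hK1R X _ _ _ _ _ _ D hD' 𝒟 hmax hscri hhyp
  haveI : 𝒟.metric.HasLeviCivita := 𝒟.metric.toPseudoRiemannianMetric.hasLeviCivita
  have hdev : DevHyp 𝒟 := ⟨hmax, hscri, hhyp.1, hhyp.2⟩
  obtain ⟨hne, Λ, r₀, hr₀, ha, hb⟩ := hA X D hD' 𝒟 hdev
  -- rigidity of every silent hull element: SEK docked, transferred through dock-ready representatives
  obtain ⟨hout, hhor⟩ := hullRigid_of_SEK_of_dockReady_of_noExtremalShadow hSEK hD hN
  -- per generator: one sub-extremal (M, a) for all horizon-hull elements (K♭ applied to R2)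
  have hgen : ∀ γ : ℝ → 𝒟.carrier, IsHorizonPath 𝒟 γ → ∃ M a : ℝ, 0 < M ∧ |a| < M ∧
      ∀ (𝓢 : Spacetime.{0} 4) (E : EndDatum 𝓢) (p : 𝓢.carrier),
        IsHorizonHullElement 𝒟 Λ r₀ γ 𝓢 E p → IsKerrDoc 𝓢 E.doc M a :=
    fun γ hγ ↦ hK X D hD' 𝒟 hdev Λ r₀ hr₀ hb γ hγ (hhor X D hD' 𝒟 hdev Λ r₀ hr₀ hb γ hγ)
  exact hT X D hD' 𝒟 hdev hne ⟨Λ, r₀, hr₀, ha, hb, hout X D hD' 𝒟 hdev Λ r₀ hr₀ hb, hgen⟩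

/-- **`ChannelsResolveTameDevelopmentsR` from the line `tame-lasalle-dock`**: the composition applied to
the seven registered stubs — the only `sorry`s of this file sit in those stubs, and this theorem concludes
the ROUTE decl by its name. -/
theorem ChannelsResolveTameDevelopmentsR_of :
    Summit.FinalStateConjecture.FinalStateConjecture.Theses.PhotonSphereChannels.ChannelsResolveTameDevelopmentsR :=
  channelsResolveTameDevelopmentsR_of_stubs stub_silentHullCore stub_silentEternalIsKerr stub_dockReadyHull
    stub_noExtremalShadow stub_kerrParametersConstantAlong stub_tameEndgame stub_settledExteriorHoldsRays

end Summit.FinalStateConjecture.FinalStateConjecture.Cruxes.ChannelsResolveTameDevelopmentsR.TameLaSalleDock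

end
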